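import Literature.NumberTheory.Weil1964.ArchMetaplecticDoubleCoverHolds
import Mathlib.MeasureTheory.Integral.DominatedConvergence
import HarnessLib

/-!
# The Gaussian multiplier of a metaplectic element on the Siegel half-space: cocycle, vacuum value, continuity

Topic `NumberTheory/Weil1964`; namespace `Literature.NumberTheory.Weil1964`.  KERNEL throughout: definitions with
bodies and proved theorems — no records, no `sorry`, no cited hypothesis.

`ArchMetaplecticDoubleCoverHolds` characterises the metaplectic elements `x` of Folland's `Mp^𝓢(W)` (`W = ℝ^σ × ℝ^σ`,
over `g = proj x ∈ Sp(W)`) by GAUSSIAN COVARIANCE: for every `τ` in the Siegel half-space `𝔥_σ`,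
`x · e^{πi ᵗyτy} = m(τ) · e^{πi ᵗy(g⋆τ)y}` with `m(τ)² · j(g,τ) = 1` (Folland's Thm. (4.65) with the multiplier (4.61)
squared; `MpS.IsGaussCovariant ↔ MpS.IsMetaplectic`).  This file turns the multiplier into a FUNCTION and records the
three properties that make it a tool for identifying two-fold covers of subgroups of `Sp(W)` (consumer:
`ArchMetaplecticUnitaryDetCharacter`, the `det^{1/2}`-cover over `U(p,q)` at every real rank):

* §1 the vacuum overlap `c(τ) = ⟪h₀, e^{πi yτy}⟫` (`MpS.vacInner`; `c(τ)² det(1 − iτ) = 2^{n/2}` is the tree's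
  `inner_toL2_hermitePi_zero_gaussS_sq`, so `c(τ) ≠ 0`; `c(i1) = 2^{−n/4}`);
* §2 the multiplier `m_x(τ) = ⟪h₀, x e^{πi yτy}⟫ / c(g⋆τ)` (`MpS.gaussMult`): for Gaussian-covariant `x` it IS the
  multiplier (`x · gaussS τ = m_x(τ) • gaussS (g⋆τ)`, `m_x(τ)² j(g,τ) = 1`), and it satisfies the COCYCLE
  `m_{xy}(τ) = m_x(h⋆τ) m_y(τ)` (Folland (4.65), first lines of the proof);
* §3 the vacuum-normalised multiplier `n_x(τ) = ⟪h₀, x e^{πi yτy}⟫ / c(τ) = m_x(τ) c(g⋆τ)/c(τ)` (`MpS.gaussMultN`):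
  `n_x(i1) = C(x)` is Folland's vacuum coefficient `⟪h₀, x h₀⟫` (`MpS.vac`), the same cocycle
  `n_{xy}(τ) = n_x(h⋆τ) n_y(τ)`, and the branch-free square `n_x(τ)² · j(g,τ) · det(1 − i(g⋆τ)) = det(1 − iτ)`;
* §4 CONTINUITY: `τ ↦ ⟪φ, e^{πi yτy}⟫` is continuous on `𝔥_σ` for every Schwartz `φ` (dominated convergence, the
  Gaussian being bounded by `1` on `𝔥_σ`), hence so are `c` and `n_x` (`x` is unitary: `⟪h₀, x γ⟫ = ⟪x⁻¹h₀, γ⟫`).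

The point of §3–§4: along a continuous family `τ(t)` the SIGN of the multiplier is pinned by continuity, which is how the
consumer identifies the restriction of the metaplectic cover to `U(p,q)` without any `KAK` decomposition.

## References

* [Folland1989] G. B. Folland, *Harmonic Analysis in Phase Space*, Princeton UP 1989, §4.2 (4.36)–(4.38), Thm. (4.37);
  §4.5 (4.61)–(4.66), Thm. (4.65).
-/

set_option autoImplicit false

noncomputable section

open MeasureTheory Complex Matrix SchwartzMap
open scoped InnerProductSpace ComplexConjugate Real ComplexOrder

namespace Literature.NumberTheory.Weil1964

open Literature.Analysis.SegalBargmann Literature.RepresentationTheory.HeisenbergGroup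
  Literature.Analysis.SpecialFunctions

variable {σ : Type*} [Fintype σ] [DecidableEq σ]

local notation "L2R" σ => Lp ℂ 2 (volume : Measure (σ → ℝ))
local notation "SR" σ => SchwartzMap (σ → ℝ) ℂ
local notation "SpR" σ => symplecticGroup (polar (dotPairing σ))

namespace MpS

/-! ## 1. The vacuum overlap of the Gaussian family -/

/-- **The vacuum overlap** `c(τ) = ⟪h₀, e^{πi ᵗyτy}⟫_{L²}` of the Gaussian at `τ`. [cite: Folland1989, §4.2 (4.36)] -/
def vacInner (τ : Matrix σ σ ℂ) : ℂ := ⟪toL2 (hermitePi (0 : σ →₀ ℕ)), toL2 (gaussS τ)⟫_ℂ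

/-- `c(τ)² · det(1 − iτ) = 2^{n/2}` on `𝔥_σ` (the tree's branch-free vacuum overlap). [cite: Folland1989, §4.2 (4.36); App. A Thm. 1] -/
theorem vacInner_sq_mul_det {τ : Matrix σ σ ℂ} (hτ : τ ∈ siegelH σ) :
    vacInner τ ^ 2 * (1 - I • τ).det = ((vacCoef σ : ℝ) : ℂ) ^ 2 :=
  inner_toL2_hermitePi_zero_gaussS_sq hτ

/-- `c(τ) ≠ 0` on `𝔥_σ`. [cite: Folland1989, §4.2 (4.36)] -/
theorem vacInner_ne_zero {τ : Matrix σ σ ℂ} (hτ : τ ∈ siegelH σ) : vacInner τ ≠ 0 := by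
  intro h
  have h1 := vacInner_sq_mul_det hτ
  rw [h, zero_pow two_ne_zero, zero_mul] at h1
  exact pow_ne_zero 2 (Complex.ofReal_ne_zero.2 (vacCoef_pos (σ := σ)).ne') h1.symm

/-- `det(1 − iτ) ≠ 0` on `𝔥_σ`. [cite: Folland1989, App. A Thm. 1] -/
theorem det_one_sub_I_smul_ne_zero {τ : Matrix σ σ ℂ} (hτ : τ ∈ siegelH σ) : (1 - I • τ).det ≠ 0 := by
  intro h
  have h1 := vacInner_sq_mul_det hτ
  rw [h, mul_zero] at h1
  exact pow_ne_zero 2 (Complex.ofReal_ne_zero.2 (vacCoef_pos (σ := σ)).ne') h1.symm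

/-- **At the base point `c(i1) = 2^{−n/4}`** (`h₀ = 2^{n/4} e^{−π|y|²}` is a unit vector). [cite: Folland1989, §1.7, §4.5 (4.62)] -/
theorem vacInner_base : vacInner (I • (1 : Matrix σ σ ℂ)) = (((vacCoef σ : ℝ) : ℂ))⁻¹ := by
  have hc : ((vacCoef σ : ℝ) : ℂ) ≠ 0 := Complex.ofReal_ne_zero.2 (vacCoef_pos (σ := σ)).ne'
  have h : toL2 (gaussS (I • (1 : Matrix σ σ ℂ))) = (((vacCoef σ : ℝ) : ℂ))⁻¹ • toL2 (hermitePi (0 : σ →₀ ℕ)) := by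
    rw [hermitePi_zero_eq_smul_gaussS, map_smul, smul_smul, inv_mul_cancel₀ hc, one_smul]
  rw [vacInner, h, inner_smul_right, toL2_hermitePi_zero, inner_vacL2_self, mul_one]

/-- The Gaussian `gaussS τ` is a non-zero Schwartz function for `τ ∈ 𝔥_σ`. [cite: Folland1989, §4.5 (4.62)] -/
theorem gaussS_ne_zero {τ : Matrix σ σ ℂ} (hτ : τ ∈ siegelH σ) : gaussS τ ≠ 0 := by
  intro h
  apply vacInner_ne_zero hτ
  rw [vacInner, h, map_zero, inner_zero_right]

/-! ## 2. The Gaussian multiplier of an element of `Mp^𝓢(W)` -/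

/-- **The Gaussian multiplier** `m_x(τ) = ⟪h₀, x e^{πi yτy}⟫ / c(g⋆τ)` of `x ∈ Mp^𝓢(W)` over `g` at `τ ∈ 𝔥_σ`
(the scalar `m(𝒜, Z)` of Folland's `μ(𝒜^{*-1})γ_Z = m(𝒜,Z)γ_{α(𝒜)Z}`, read in the Schrödinger model).
[cite: Folland1989, §4.5 Thm. (4.65), (4.61)] -/
def gaussMult (x : MpS σ) (τ : Matrix σ σ ℂ) : ℂ :=
  ⟪toL2 (hermitePi (0 : σ →₀ ℕ)), toL2 (x.1.2 (gaussS τ))⟫_ℂ / vacInner (Sp.sact (proj x) τ)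

/-- **For a Gaussian-covariant element the multiplier is `gaussMult`**: `x · e^{πi yτy} = m_x(τ) · e^{πi y(g⋆τ)y}`.
[cite: Folland1989, §4.5 Thm. (4.65)] -/
theorem IsGaussCovariant.apply_gaussS {x : MpS σ} (hx : IsGaussCovariant x) {τ : Matrix σ σ ℂ} (hτ : τ ∈ siegelH σ) :
    x.1.2 (gaussS τ) = gaussMult x τ • gaussS (Sp.sact (proj x) τ) := by
  obtain ⟨m, hm, -⟩ := hx τ hτ
  have hc := vacInner_ne_zero (Sp.sact_mem (proj x) hτ)
  have hval : gaussMult x τ = m := by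
    rw [gaussMult, hm, map_smul, inner_smul_right, ← vacInner, mul_div_assoc, div_self hc, mul_one]
  rw [hval, hm]

/-- **`m_x(τ)² · j(g, τ) = 1`** for Gaussian-covariant `x`. [cite: Folland1989, §4.5 Thm. (4.65), (4.61)] -/
theorem IsGaussCovariant.gaussMult_sq_mul_sJ {x : MpS σ} (hx : IsGaussCovariant x) {τ : Matrix σ σ ℂ}
    (hτ : τ ∈ siegelH σ) : gaussMult x τ ^ 2 * Sp.sJ (proj x) τ = 1 := by
  obtain ⟨m, hm, hm2⟩ := hx τ hτ
  have hc := vacInner_ne_zero (Sp.sact_mem (proj x) hτ)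
  have hval : gaussMult x τ = m := by
    rw [gaussMult, hm, map_smul, inner_smul_right, ← vacInner, mul_div_assoc, div_self hc, mul_one]
  rw [hval, hm2]

/-- `m_x(τ) ≠ 0` for Gaussian-covariant `x`. [cite: Folland1989, §4.5 (4.61)] -/
theorem IsGaussCovariant.gaussMult_ne_zero {x : MpS σ} (hx : IsGaussCovariant x) {τ : Matrix σ σ ℂ}
    (hτ : τ ∈ siegelH σ) : gaussMult x τ ≠ 0 := by
  intro h
  have h1 := hx.gaussMult_sq_mul_sJ hτ
  rw [h, zero_pow two_ne_zero, zero_mul] at h1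
  exact zero_ne_one h1

/-- **The cocycle of the multiplier**: `m_{xy}(τ) = m_x(h⋆τ) · m_y(τ)` (first lines of the proof of Folland's
Thm. (4.65): `j(gh,τ) = j(g,h⋆τ) j(h,τ)`). [cite: Folland1989, §4.5 (4.62), Thm. (4.65)] -/
theorem IsGaussCovariant.gaussMult_mul {x y : MpS σ} (hx : IsGaussCovariant x) (hy : IsGaussCovariant y)
    {τ : Matrix σ σ ℂ} (hτ : τ ∈ siegelH σ) :
    gaussMult (x * y) τ = gaussMult x (Sp.sact (proj y) τ) * gaussMult y τ := by
  have hτ₁ := Sp.sact_mem (proj y) hτ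
  have h1 : (x * y).1.2 (gaussS τ) = (gaussMult x (Sp.sact (proj y) τ) * gaussMult y τ) •
      gaussS (Sp.sact (proj (x * y)) τ) := by
    rw [mul_apply, hy.apply_gaussS hτ, map_smul, hx.apply_gaussS hτ₁, smul_smul, map_mul, Sp.sact_mul _ _ hτ,
      mul_comm]
  have h2 := (hx.mul hy).apply_gaussS hτ
  rw [h1] at h2
  exact (smul_left_injective ℂ (gaussS_ne_zero (Sp.sact_mem _ hτ)) h2).symm

/-! ## 3. The vacuum-normalised multiplier -/

/-- **The vacuum-normalised Gaussian multiplier** `n_x(τ) = ⟪h₀, x e^{πi yτy}⟫ / c(τ)`: the vacuum component of the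
image of the NORMALISED Gaussian `e^{πi yτy}/c(τ)`.  At the base point it is Folland's vacuum coefficient `C(x)`.
[cite: Folland1989, §4.2 (4.36), §4.5 Thm. (4.65)] -/
def gaussMultN (x : MpS σ) (τ : Matrix σ σ ℂ) : ℂ :=
  ⟪toL2 (hermitePi (0 : σ →₀ ℕ)), toL2 (x.1.2 (gaussS τ))⟫_ℂ / vacInner τ

/-- `n_x(τ) = m_x(τ) · c(g⋆τ) / c(τ)`. [cite: Folland1989, §4.5 Thm. (4.65)] -/
theorem gaussMultN_eq (x : MpS σ) {τ : Matrix σ σ ℂ} (hτ : τ ∈ siegelH σ) :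
    gaussMultN x τ = gaussMult x τ * vacInner (Sp.sact (proj x) τ) / vacInner τ := by
  rw [gaussMultN, gaussMult, div_mul_cancel₀ _ (vacInner_ne_zero (Sp.sact_mem (proj x) hτ))]

/-- **At the base point `n_x(i1) = C(x) = ⟪h₀, x h₀⟫`** (Folland's vacuum coefficient `MpS.vac`).
[cite: Folland1989, §4.2 (4.36)] -/
theorem gaussMultN_base (x : MpS σ) : gaussMultN x (I • (1 : Matrix σ σ ℂ)) = vac x := by
  have hc : ((vacCoef σ : ℝ) : ℂ) ≠ 0 := Complex.ofReal_ne_zero.2 (vacCoef_pos (σ := σ)).ne'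
  have h : gaussS (I • (1 : Matrix σ σ ℂ)) = (((vacCoef σ : ℝ) : ℂ))⁻¹ • hermitePi (0 : σ →₀ ℕ) := by
    rw [hermitePi_zero_eq_smul_gaussS, smul_smul, inv_mul_cancel₀ hc, one_smul]
  rw [gaussMultN, vacInner_base, h, map_smul, map_smul, inner_smul_right, vac_apply, toL2_hermitePi_zero]
  field_simp

/-- **The branch-free square**: `n_x(τ)² · j(g, τ) · det(1 − i(g⋆τ)) = det(1 − iτ)` for Gaussian-covariant `x`
(from `m² j = 1` and `c(τ)² det(1 − iτ) = 2^{n/2}`). [cite: Folland1989, §4.5 Thm. (4.65); App. A Thm. 1] -/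
theorem IsGaussCovariant.gaussMultN_sq {x : MpS σ} (hx : IsGaussCovariant x) {τ : Matrix σ σ ℂ}
    (hτ : τ ∈ siegelH σ) :
    gaussMultN x τ ^ 2 * Sp.sJ (proj x) τ * (1 - I • Sp.sact (proj x) τ).det = (1 - I • τ).det := by
  have hτ₁ := Sp.sact_mem (proj x) hτ
  have hc := vacInner_ne_zero hτ
  have hd := det_one_sub_I_smul_ne_zero hτ
  have h1 := hx.gaussMult_sq_mul_sJ hτ
  have h2 := vacInner_sq_mul_det hτ
  have h3 := vacInner_sq_mul_det hτ₁
  rw [gaussMultN_eq x hτ]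
  -- clear denominators: multiply the claim by `c(τ)²`
  have key : (gaussMult x τ * vacInner (Sp.sact (proj x) τ) / vacInner τ) ^ 2 * Sp.sJ (proj x) τ *
      (1 - I • Sp.sact (proj x) τ).det * (vacInner τ ^ 2 * (1 - I • τ).det) =
        (1 - I • τ).det * (vacInner τ ^ 2 * (1 - I • τ).det) := by
    rw [div_pow, mul_pow]
    calc gaussMult x τ ^ 2 * vacInner (Sp.sact (proj x) τ) ^ 2 / vacInner τ ^ 2 * Sp.sJ (proj x) τ *
          (1 - I • Sp.sact (proj x) τ).det * (vacInner τ ^ 2 * (1 - I • τ).det)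
        = (gaussMult x τ ^ 2 * Sp.sJ (proj x) τ) *
            (vacInner (Sp.sact (proj x) τ) ^ 2 * (1 - I • Sp.sact (proj x) τ).det) * (1 - I • τ).det *
            (vacInner τ ^ 2 / vacInner τ ^ 2) := by ring
      _ = (1 - I • τ).det * (vacInner τ ^ 2 * (1 - I • τ).det) := by
          rw [h1, h3, h2, div_self (pow_ne_zero 2 hc)]; ring
  exact mul_right_cancel₀ (mul_ne_zero (pow_ne_zero 2 hc) hd) key

/-- **The cocycle of the normalised multiplier**: `n_{xy}(τ) = n_x(h⋆τ) · n_y(τ)`.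
[cite: Folland1989, §4.5 (4.62), Thm. (4.65)] -/
theorem IsGaussCovariant.gaussMultN_mul {x y : MpS σ} (hx : IsGaussCovariant x) (hy : IsGaussCovariant y)
    {τ : Matrix σ σ ℂ} (hτ : τ ∈ siegelH σ) :
    gaussMultN (x * y) τ = gaussMultN x (Sp.sact (proj y) τ) * gaussMultN y τ := by
  have hτ₁ := Sp.sact_mem (proj y) hτ
  have hc := vacInner_ne_zero hτ
  have hc₁ := vacInner_ne_zero hτ₁
  rw [gaussMultN_eq _ hτ, gaussMultN_eq _ hτ₁, gaussMultN_eq _ hτ, hx.gaussMult_mul hy hτ, map_mul,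
    Sp.sact_mul _ _ hτ]
  field_simp

/-- `n_{(−1)·x} = −n_x`. [cite: Folland1989, §4.2 Thm. (4.37)] -/
theorem gaussMultN_negOne_mul (x : MpS σ) (τ : Matrix σ σ ℂ) : gaussMultN (negOne * x) τ = -gaussMultN x τ := by
  rw [gaussMultN, gaussMultN, mul_apply, negOne_apply, map_neg, inner_neg_right, neg_div]

/-! ## 4. Continuity in `τ` -/

omit [DecidableEq σ] in
/-- On `𝔥_σ` the Gaussian is bounded by `1`: `|e^{πi ᵗyτy}| = e^{−π ᵗy(Im τ)y} ≤ 1`. [cite: Folland1989, §4.5 (4.62)] -/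
theorem norm_gaussFun_le_one {τ : Matrix σ σ ℂ} (hτ : τ ∈ siegelH σ) (y : σ → ℝ) : ‖gaussFun τ y‖ ≤ 1 := by
  rw [gaussFun_apply, Complex.norm_exp, cvec_dotProduct_mulVec_cvec]
  have him : 0 ≤ y ⬝ᵥ (τ.map Complex.im *ᵥ y) := by
    have := hτ.2.posSemidef.dotProduct_mulVec_nonneg y
    rwa [star_trivial] at this
  have hre : ((π : ℂ) * I * (((y ⬝ᵥ (τ.map Complex.re *ᵥ y) : ℝ) : ℂ) +
      I * ((y ⬝ᵥ (τ.map Complex.im *ᵥ y) : ℝ) : ℂ))).re = -(π * (y ⬝ᵥ (τ.map Complex.im *ᵥ y))) := by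
    simp [Complex.mul_re, Complex.mul_im, mul_comm]
  rw [hre, Real.exp_le_one_iff]
  nlinarith [Real.pi_pos]

omit [DecidableEq σ] in
/-- `τ ↦ e^{πi ᵗyτy}` is continuous (for fixed `y`). [cite: Folland1989, §4.5 (4.62)] -/
theorem continuous_gaussFun_left (y : σ → ℝ) : Continuous fun τ : Matrix σ σ ℂ => gaussFun τ y := by
  unfold gaussFun
  exact Complex.continuous_exp.comp (continuous_const.mul
    (continuous_const.dotProduct (continuous_id.matrix_mulVec continuous_const)))

omit [DecidableEq σ] in
/-- `y ↦ e^{πi ᵗyτy}` is continuous (for fixed `τ`). [cite: Folland1989, §4.5 (4.62)] -/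
theorem continuous_gaussFun_right (τ : Matrix σ σ ℂ) : Continuous (gaussFun τ : (σ → ℝ) → ℂ) := by
  have hc : Continuous (cvec : (σ → ℝ) → σ → ℂ) :=
    continuous_pi fun k => Complex.continuous_ofReal.comp (continuous_apply k)
  unfold gaussFun
  exact Complex.continuous_exp.comp (continuous_const.mul (hc.dotProduct (continuous_const.matrix_mulVec hc)))

omit [DecidableEq σ] in
/-- `⟪toL2 u, toL2 v⟫ = ∫ conj(u) v`. [cite: Folland1989, §1.7] -/
private theorem inner_toL2_eq_integral (u v : SR σ) : ⟪toL2 u, toL2 v⟫_ℂ = ∫ y, conj (u y) * v y := by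
  rw [MeasureTheory.L2.inner_def]
  refine integral_congr_ae ?_
  filter_upwards [coeFn_toL2 u, coeFn_toL2 v] with y hu hv
  rw [hu, hv]
  exact RCLike.inner_apply' _ _

/-- **Continuity of the Gaussian family against a Schwartz function**: `τ ↦ ⟪φ, e^{πi yτy}⟫_{L²}` is continuous on
`𝔥_σ` (dominated convergence with the integrable bound `|φ|`). [cite: Folland1989, §4.5 (4.62)] -/
theorem continuousOn_inner_toL2_gaussS (φ : SR σ) :
    ContinuousOn (fun τ : Matrix σ σ ℂ => ⟪toL2 φ, toL2 (gaussS τ)⟫_ℂ) (siegelH σ) := by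
  haveI : FirstCountableTopology (Matrix σ σ ℂ) := inferInstanceAs (FirstCountableTopology (σ → σ → ℂ))
  have hF : ContinuousOn (fun τ : Matrix σ σ ℂ => ∫ y, conj (φ y) * gaussFun τ y) (siegelH σ) := by
    refine MeasureTheory.continuousOn_of_dominated (bound := fun y => ‖φ y‖) ?_ ?_ ?_ ?_
    · intro τ _
      exact ((SchwartzMap.continuous φ).star.mul (continuous_gaussFun_right τ)).aestronglyMeasurable
    · intro τ hτ
      refine Filter.Eventually.of_forall fun y => ?_
      rw [norm_mul, Complex.norm_conj]
      exact mul_le_of_le_one_right (norm_nonneg _) (norm_gaussFun_le_one hτ y)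
    · exact (SchwartzMap.integrable φ).norm
    · refine Filter.Eventually.of_forall fun y => ?_
      exact (continuous_const.mul (continuous_gaussFun_left y)).continuousOn
  refine hF.congr fun τ hτ => ?_
  rw [inner_toL2_eq_integral]
  refine integral_congr_ae (Filter.Eventually.of_forall fun y => ?_)
  change conj (φ y) * gaussS τ y = conj (φ y) * gaussFun τ y
  rw [gaussS_apply hτ]

/-- The vacuum overlap `c` is continuous on `𝔥_σ`. [cite: Folland1989, §4.2 (4.36)] -/
theorem continuousOn_vacInner : ContinuousOn (vacInner (σ := σ)) (siegelH σ) :=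
  continuousOn_inner_toL2_gaussS _

/-- **Unitarity moves `x` across the pairing**: `⟪h₀, x f⟫ = ⟪x⁻¹ h₀, f⟫` for `x ∈ Mp^𝓢(W)` (the operator of `x` is the
restriction of a unitary operator of `L²`). [cite: Folland1989, §4.2 Thm. (4.37)(a)] -/
theorem inner_apply_eq_inner_inv_apply (x : MpS σ) (f : SR σ) :
    ⟪toL2 (hermitePi (0 : σ →₀ ℕ)), toL2 (x.1.2 f)⟫_ℂ = ⟪toL2 ((x⁻¹).1.2 (hermitePi (0 : σ →₀ ℕ))), toL2 f⟫_ℂ := by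
  obtain ⟨U, hU⟩ := ((mem_iff _).1 x.2).2
  have h1 : toL2 (x.1.2 f) = U (toL2 f) := hU f
  have h2 : toL2 (x.1.2 ((x⁻¹).1.2 (hermitePi (0 : σ →₀ ℕ)))) = U (toL2 ((x⁻¹).1.2 (hermitePi 0))) := hU _
  rw [← mul_apply, mul_inv_cancel] at h2
  change toL2 (hermitePi 0) = _ at h2
  rw [h1, h2]
  exact U.inner_map_map _ _

/-- **The normalised multiplier `n_x` is continuous on `𝔥_σ`** for every `x ∈ Mp^𝓢(W)`. [cite: Folland1989, §4.5 Thm. (4.65)] -/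
theorem continuousOn_gaussMultN (x : MpS σ) : ContinuousOn (gaussMultN x) (siegelH σ) := by
  have h : gaussMultN x = fun τ =>
      ⟪toL2 ((x⁻¹).1.2 (hermitePi (0 : σ →₀ ℕ))), toL2 (gaussS τ)⟫_ℂ / vacInner τ := funext fun τ => by
    rw [gaussMultN, inner_apply_eq_inner_inv_apply]
  rw [h]
  exact (continuousOn_inner_toL2_gaussS _).div continuousOn_vacInner fun τ hτ => vacInner_ne_zero hτ

end MpS

end Literature.NumberTheory.Weil1964
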